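import Summits.HubbardSuperconductivity.HubbardSuperconductivity.Theorems.LiebTwinDWavePolarisedDiscordanceStubMassFeedsOfCrux
import Summits.HubbardSuperconductivity.HubbardSuperconductivity.Theorems.LiebTwinDWavePolarisedDiscordanceChannelBound
import Summits.HubbardSuperconductivity.HubbardSuperconductivity.Theorems.LiebTwinTwinOnsiteCondensationTwinPairOrderIdentity
import Summits.HubbardSuperconductivity.HubbardSuperconductivity.Theorems.LiebTwinBondLocalityGlue
import Literature.MathematicalPhysics.QuantumLattice.HubbardRingPerronFrobeniusProofs

/-!
# Route `LiebTwin`, crux `DWavePolarisedDiscordance` (K3′, stmt-HubbardSuperconductivity-15314):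
# the summit sandwich of its usable content K3″ (strategist r1, `--supports`)

Write, for a normalised sector ground state `φ` with twin `φ̃ = liebVec n |liebW n φ|`
(`n = ⌊(1-δ)L²/2⌋`): `m = F_s(φ̃) − F_s(φ)` (discordance mass), `D = F_d(φ)`, `D′ = F_d(φ̃)`,
`X = F_xs(φ)` (`F_g = Re⟨·, Δ_gᴴ Δ_g ·⟩`, `Δ_g = pairField g L`). The crux K3′ reads
`κ·m − εL⁴ ≤ D − D′`; its usable content (what `closes` consumes, line `registered`, p147389/p153625) is
the bond-locality form K3″ `κ·m − εL⁴ ≤ D + X`.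

This file places K3″ and K3′ relative to the summit's own matrix (a uniform `L⁴` floor under `F_d`
of EVERY normalised sector ground state), with everything kernel-checked and elementary:

* `bondLocalityAt_of_dWaveFloorAt` / `bondLocality_of_uniformBoxDWaveFloor` — **the summit matrix,
  uniformly on the box, implies K3″** (`κ = a/2`): Yang's cap for twins
  `F_s(φ̃) ≤ 2n(L²−n+1) ≤ 2L⁴` (`LiebTwinTwin.re_expect_pairField_sWave_twin_le`) bounds the mass, so a
  d-wave floor `aL⁴ ≤ D` absorbs `(a/2)·m`. Hence K3″ is a CONSEQUENCE of the box-uniform summit.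
* `dWaveFloorAt_of_bondLocalityAt` — conversely, at any box point where the mass has a uniform floor
  `μL⁴ ≤ m` and the extended-s order is `o(L⁴)` (the K2 ∧ NoOnsite regime of the route), K3″ IS the
  summit matrix there: `(κμ/2)L⁴ ≤ D` for every normalised sector ground state.
  Together: **K3″ has content only at massive points, and there it is literally the every-ground-state
  d-wave floor of the summit** (the certificate behind the strategist verdict `no-strategy-short-of-summit`).
* `discordanceAt_of_bondLocalityAt_of_twinSubordinateAt` — the best typed two-piece split of K3′ proper,
  with its assembly PROVED: K3″ with constant `κ` plus "twin subordination" `X + D′ ≤ θ·m + εL⁴` with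
  `θ < κ` give K3′ with constant `κ − θ`. (Not filed as a route split: the second piece is an engine-less
  statement about the twin's d-order, coupled to K3″'s constant; see `Cruxes/…/STRATEGY-CENSUS.md` r1.)
* `twin_dWave_le_of_dWavePolarisedDiscordance` — K3′ proper carries, beyond K3″, a statement about the
  TWIN alone: along real flip-definite ground states the twin never out-d-waves the state by a
  macroscopic amount, `D′ ≤ D + εL⁴` (uses `m ≥ 0`, `LiebTwinDiscordance.re_expect_sWave_le_twin_of_real`).
  This consequence is implied by no summit-type statement and is a stand-alone refutation target for K3′
  (lead c1's 4×4 exact diagonalisation has `D′ > D` at `(N,U) = (6,4), (10,1), (10,2)`).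

Sources: E. H. Lieb, PRL 62 (1989) 1201 (proof of Thm 1); C. N. Yang, Rev. Mod. Phys. 34 (1962) 694, §4;
D. J. Scalapino, Phys. Rep. 250 (1995) 329, §2. Folklore finite-dimensional bookkeeping; no definition,
no named fact, no `sorry`.
-/

noncomputable section

-- `dupNamespace`: the summit and the problem are both named `HubbardSuperconductivity` (layout D-0022)
set_option linter.dupNamespace false

namespace Summit.HubbardSuperconductivity.HubbardSuperconductivity.Theorems.LiebTwinDiscordance.SummitSandwich

open Matrix Literature.MathematicalPhysics.QuantumLattice Literature.Probability.LatticeModels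
open scoped ComplexOrder MatrixOrder Matrix.Norms.L2Operator

/-! ### Pointwise statements at a box point `(U, δ)` (explicit constants) -/

section Pointwise

variable {U δ : ℝ}

/-- **Summit floor ⇒ K3″ at a point.** If every normalised `(2n, 0)`-sector ground state eventually has
`aL⁴ ≤ F_d`, then K3″ holds at `(U, δ)` with `κ = a/2` and the SAME `L₀` for every `ε > 0`:
`(a/2)·m ≤ (a/2)·F_s(φ̃) ≤ (a/2)·2L⁴ ≤ F_d(φ) ≤ F_d(φ) + F_xs(φ)` by Yang's cap for twins
`F_s(φ̃) ≤ 2n(L² − n + 1) ≤ 2L⁴` and `F_s(φ), F_xs(φ) ≥ 0`. Yang, Rev. Mod. Phys. 34 (1962) 694 §4;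
Lieb, PRL 62 (1989) 1201. [folklore] -/
theorem bondLocalityAt_of_dWaveFloorAt {a : ℝ} (ha : 0 < a) {L₀ : ℕ}
    (hS : ∀ (L : ℕ) [NeZero L], L₀ ≤ L → Even L → ∀ φ : Fock (Orb (FermionTorus 2 L)), star φ ⬝ᵥ φ = 1 →
        IsGroundStateInSector (hubbardTorus 2 L 1 U) (2 * ⌊(1 - δ) * (L : ℝ) ^ 2 / 2⌋₊) 0 φ →
          a * (L : ℝ) ^ 4 ≤ (expect ((pairField dWaveFormFactor L)ᴴ * pairField dWaveFormFactor L) φ).re)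
    {ε : ℝ} (hε : 0 < ε) :
    ∀ (L : ℕ) [NeZero L], L₀ ≤ L → Even L → ∀ φ : Fock (Orb (FermionTorus 2 L)),
        star φ ⬝ᵥ φ = 1 →
          IsGroundStateInSector (hubbardTorus 2 L 1 U) (2 * ⌊(1 - δ) * (L : ℝ) ^ 2 / 2⌋₊) 0 φ →
            a / 2 * ((expect ((pairField sWave L)ᴴ * pairField sWave L)
                    (liebVec ⌊(1 - δ) * (L : ℝ) ^ 2 / 2⌋₊
                      (CFC.abs (liebW ⌊(1 - δ) * (L : ℝ) ^ 2 / 2⌋₊ φ)))).re -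
                  (expect ((pairField sWave L)ᴴ * pairField sWave L) φ).re) -
                ε * (L : ℝ) ^ 4 ≤
              (expect ((pairField dWaveFormFactor L)ᴴ * pairField dWaveFormFactor L) φ).re +
                (expect ((pairField extendedSWave L)ᴴ * pairField extendedSWave L) φ).re := by
  intro L _ hL hE φ hφ hgs
  set n := ⌊(1 - δ) * (L : ℝ) ^ 2 / 2⌋₊ with hn
  have hD := hS L hL hE φ hφ hgs
  have hsec : IsInSector n n φ := (mem_szSector_two_mul_zero_iff n φ).1 hgs.1
  have hY := LiebTwinTwin.re_expect_pairField_sWave_twin_le (L := L) hsec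
  rw [hφ, Complex.one_re, mul_one] at hY
  have hFs := re_expect_pairField_conjTranspose_mul_nonneg sWave L φ
  have hX := re_expect_pairField_conjTranspose_mul_nonneg extendedSWave L φ
  have hL1 : (1 : ℝ) ≤ (L : ℝ) ^ 2 := by
    have h1 : (1 : ℝ) ≤ L := by exact_mod_cast Nat.one_le_iff_ne_zero.mpr (NeZero.ne L)
    nlinarith
  have hcap : 2 * ((n : ℝ) * ((L : ℝ) ^ 2 - n + 1)) ≤ 2 * (L : ℝ) ^ 4 := by
    nlinarith [sq_nonneg ((n : ℝ) - ((L : ℝ) ^ 2 + 1) / 2), hL1]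
  have h1 : a / 2 * (expect ((pairField sWave L)ᴴ * pairField sWave L)
        (liebVec n (CFC.abs (liebW n φ)))).re ≤ a / 2 * (2 * (L : ℝ) ^ 4) :=
    mul_le_mul_of_nonneg_left (hY.trans hcap) (by positivity)
  have h2 : 0 ≤ a / 2 * (expect ((pairField sWave L)ᴴ * pairField sWave L) φ).re :=
    mul_nonneg (by positivity) hFs
  have h3 : 0 ≤ ε * (L : ℝ) ^ 4 := by positivity
  rw [mul_sub]
  linarith

/-- **K3″ + uniform mass floor + extended-s smallness ⇒ the summit matrix at the point.** If at `(U, δ)`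
K3″ holds with constant `κ`, the discordance mass of every normalised sector ground state is eventually
`≥ μL⁴`, and its extended-s order is eventually `≤ εL⁴` for every `ε > 0` (e.g. the K2 ∧ NoOnsiteODLRO
regime of route `LiebTwin`: mass `≥ (3c/4)L⁴`, `F_xs ≤ εL⁴` by A1g slaving), then every normalised sector
ground state eventually has `(κμ/2)L⁴ ≤ F_d` — K3″ at a massive point IS the every-ground-state d-wave
floor. Lieb, PRL 62 (1989) 1201; Scalapino, Phys. Rep. 250 (1995) 329, §2. [folklore] -/
theorem dWaveFloorAt_of_bondLocalityAt {κ μ : ℝ} (hκ : 0 < κ) (hμ : 0 < μ)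
    (hK3 : ∀ ε : ℝ, 0 < ε → ∃ L₀ : ℕ, ∀ (L : ℕ) [NeZero L], L₀ ≤ L → Even L →
      ∀ φ : Fock (Orb (FermionTorus 2 L)), star φ ⬝ᵥ φ = 1 →
        IsGroundStateInSector (hubbardTorus 2 L 1 U) (2 * ⌊(1 - δ) * (L : ℝ) ^ 2 / 2⌋₊) 0 φ →
          κ * ((expect ((pairField sWave L)ᴴ * pairField sWave L)
                  (liebVec ⌊(1 - δ) * (L : ℝ) ^ 2 / 2⌋₊
                    (CFC.abs (liebW ⌊(1 - δ) * (L : ℝ) ^ 2 / 2⌋₊ φ)))).re -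
                (expect ((pairField sWave L)ᴴ * pairField sWave L) φ).re) -
              ε * (L : ℝ) ^ 4 ≤
            (expect ((pairField dWaveFormFactor L)ᴴ * pairField dWaveFormFactor L) φ).re +
              (expect ((pairField extendedSWave L)ᴴ * pairField extendedSWave L) φ).re)
    (hm : ∃ L₀ : ℕ, ∀ (L : ℕ) [NeZero L], L₀ ≤ L → Even L →
      ∀ φ : Fock (Orb (FermionTorus 2 L)), star φ ⬝ᵥ φ = 1 →
        IsGroundStateInSector (hubbardTorus 2 L 1 U) (2 * ⌊(1 - δ) * (L : ℝ) ^ 2 / 2⌋₊) 0 φ →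
          μ * (L : ℝ) ^ 4 ≤
            (expect ((pairField sWave L)ᴴ * pairField sWave L)
                (liebVec ⌊(1 - δ) * (L : ℝ) ^ 2 / 2⌋₊
                  (CFC.abs (liebW ⌊(1 - δ) * (L : ℝ) ^ 2 / 2⌋₊ φ)))).re -
              (expect ((pairField sWave L)ᴴ * pairField sWave L) φ).re)
    (hxs : ∀ ε : ℝ, 0 < ε → ∃ L₀ : ℕ, ∀ (L : ℕ) [NeZero L], L₀ ≤ L → Even L →
      ∀ φ : Fock (Orb (FermionTorus 2 L)), star φ ⬝ᵥ φ = 1 →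
        IsGroundStateInSector (hubbardTorus 2 L 1 U) (2 * ⌊(1 - δ) * (L : ℝ) ^ 2 / 2⌋₊) 0 φ →
          (expect ((pairField extendedSWave L)ᴴ * pairField extendedSWave L) φ).re ≤ ε * (L : ℝ) ^ 4) :
    ∃ L₀ : ℕ, ∀ (L : ℕ) [NeZero L], L₀ ≤ L → Even L →
      ∀ φ : Fock (Orb (FermionTorus 2 L)), star φ ⬝ᵥ φ = 1 →
        IsGroundStateInSector (hubbardTorus 2 L 1 U) (2 * ⌊(1 - δ) * (L : ℝ) ^ 2 / 2⌋₊) 0 φ →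
          κ * μ / 2 * (L : ℝ) ^ 4 ≤
            (expect ((pairField dWaveFormFactor L)ᴴ * pairField dWaveFormFactor L) φ).re := by
  obtain ⟨L₁, h3⟩ := hK3 (κ * μ / 4) (by positivity)
  obtain ⟨L₂, h2⟩ := hm
  obtain ⟨L₃, hx⟩ := hxs (κ * μ / 4) (by positivity)
  refine ⟨L₁ + L₂ + L₃, fun L _ hL hE φ hφ hgs => ?_⟩
  have i3 := h3 L (by omega) hE φ hφ hgs
  have i2 := h2 L (by omega) hE φ hφ hgs
  have ix := hx L (by omega) hE φ hφ hgs
  have hκm := mul_le_mul_of_nonneg_left i2 hκ.le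
  nlinarith [hκm, i3, ix]

/-- **The best typed split of K3′, assembly proved.** At `(U, δ)`: K3″ with constant `κ` and the
"twin subordination" budget `F_xs(φ) + F_d(φ̃) ≤ θ·m + εL⁴` (every `ε > 0`, eventually, every normalised
sector ground state) with `θ < κ` give K3′ with constant `κ − θ`:
`D − D′ = (D + X) − (X + D′) ≥ κm − θm − εL⁴`. (The second piece is a statement about the twin's own
d-wave order; nothing summit-type implies it.) Lieb, PRL 62 (1989) 1201. [folklore] -/
theorem discordanceAt_of_bondLocalityAt_of_twinSubordinateAt {κ θ : ℝ}
    (hK3 : ∀ ε : ℝ, 0 < ε → ∃ L₀ : ℕ, ∀ (L : ℕ) [NeZero L], L₀ ≤ L → Even L →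
      ∀ φ : Fock (Orb (FermionTorus 2 L)), star φ ⬝ᵥ φ = 1 →
        IsGroundStateInSector (hubbardTorus 2 L 1 U) (2 * ⌊(1 - δ) * (L : ℝ) ^ 2 / 2⌋₊) 0 φ →
          κ * ((expect ((pairField sWave L)ᴴ * pairField sWave L)
                  (liebVec ⌊(1 - δ) * (L : ℝ) ^ 2 / 2⌋₊
                    (CFC.abs (liebW ⌊(1 - δ) * (L : ℝ) ^ 2 / 2⌋₊ φ)))).re -
                (expect ((pairField sWave L)ᴴ * pairField sWave L) φ).re) -
              ε * (L : ℝ) ^ 4 ≤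
            (expect ((pairField dWaveFormFactor L)ᴴ * pairField dWaveFormFactor L) φ).re +
              (expect ((pairField extendedSWave L)ᴴ * pairField extendedSWave L) φ).re)
    (hSub : ∀ ε : ℝ, 0 < ε → ∃ L₀ : ℕ, ∀ (L : ℕ) [NeZero L], L₀ ≤ L → Even L →
      ∀ φ : Fock (Orb (FermionTorus 2 L)), star φ ⬝ᵥ φ = 1 →
        IsGroundStateInSector (hubbardTorus 2 L 1 U) (2 * ⌊(1 - δ) * (L : ℝ) ^ 2 / 2⌋₊) 0 φ →
          (expect ((pairField extendedSWave L)ᴴ * pairField extendedSWave L) φ).re +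
              (expect ((pairField dWaveFormFactor L)ᴴ * pairField dWaveFormFactor L)
                (liebVec ⌊(1 - δ) * (L : ℝ) ^ 2 / 2⌋₊
                  (CFC.abs (liebW ⌊(1 - δ) * (L : ℝ) ^ 2 / 2⌋₊ φ)))).re ≤
            θ * ((expect ((pairField sWave L)ᴴ * pairField sWave L)
                  (liebVec ⌊(1 - δ) * (L : ℝ) ^ 2 / 2⌋₊
                    (CFC.abs (liebW ⌊(1 - δ) * (L : ℝ) ^ 2 / 2⌋₊ φ)))).re -
                (expect ((pairField sWave L)ᴴ * pairField sWave L) φ).re) +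
              ε * (L : ℝ) ^ 4) :
    ∀ ε : ℝ, 0 < ε → ∃ L₀ : ℕ, ∀ (L : ℕ) [NeZero L], L₀ ≤ L → Even L →
      ∀ φ : Fock (Orb (FermionTorus 2 L)), star φ ⬝ᵥ φ = 1 →
        IsGroundStateInSector (hubbardTorus 2 L 1 U) (2 * ⌊(1 - δ) * (L : ℝ) ^ 2 / 2⌋₊) 0 φ →
          (κ - θ) * ((expect ((pairField sWave L)ᴴ * pairField sWave L)
                  (liebVec ⌊(1 - δ) * (L : ℝ) ^ 2 / 2⌋₊
                    (CFC.abs (liebW ⌊(1 - δ) * (L : ℝ) ^ 2 / 2⌋₊ φ)))).re -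
                (expect ((pairField sWave L)ᴴ * pairField sWave L) φ).re) -
              ε * (L : ℝ) ^ 4 ≤
            (expect ((pairField dWaveFormFactor L)ᴴ * pairField dWaveFormFactor L) φ).re -
              (expect ((pairField dWaveFormFactor L)ᴴ * pairField dWaveFormFactor L)
                (liebVec ⌊(1 - δ) * (L : ℝ) ^ 2 / 2⌋₊
                  (CFC.abs (liebW ⌊(1 - δ) * (L : ℝ) ^ 2 / 2⌋₊ φ)))).re := by
  intro ε hε
  obtain ⟨L₁, h3⟩ := hK3 (ε / 2) (by positivity)
  obtain ⟨L₂, hs⟩ := hSub (ε / 2) (by positivity)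
  refine ⟨L₁ + L₂, fun L _ hL hE φ hφ hgs => ?_⟩
  have i3 := h3 L (by omega) hE φ hφ hgs
  have is := hs L (by omega) hE φ hφ hgs
  rw [sub_mul]
  linarith

/-- **Closing the chain: the summit matrix at ONE box point already gives the summit constant**
(so `dWaveFloorAt_of_bondLocalityAt` composed with it is exactly how the route closes, and K3″ at a
massive point is summit-strength in the literal sense). Mirrors the tail of
`LiebTwinBondLocality.hubbardSuperconductivity_of_bondLocality` (even-side `liminf` bookkeeping
`IntrinsicLargeN.uniformLROGivesSummitMatrix_proof`). Scalapino, Phys. Rep. 250 (1995) 329, §2. [folklore] -/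
theorem hubbardSuperconductivity_of_dWaveFloorAt {U δ : ℝ} (hU : U ∈ Set.Ioc (0 : ℝ) 4)
    (hδ : δ ∈ Set.Icc (1 / 10 : ℝ) (3 / 10))
    (floor : ∃ a : ℝ, 0 < a ∧ ∃ L₀ : ℕ, ∀ (L : ℕ) [NeZero L], L₀ ≤ L → Even L →
      ∀ ψ : Fock (Orb (FermionTorus 2 L)), star ψ ⬝ᵥ ψ = 1 →
        IsGroundStateInSector (hubbardTorus 2 L 1 U) (2 * ⌊(1 - δ) * (L : ℝ) ^ 2 / 2⌋₊) 0 ψ →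
          a * (L : ℝ) ^ 4 ≤ (expect ((pairField dWaveFormFactor L)ᴴ * pairField dWaveFormFactor L) ψ).re) :
    _root_.HubbardSuperconductivity := by
  have hmat := IntrinsicLargeN.uniformLROGivesSummitMatrix_proof U δ floor
  have hδ' : δ ∈ Set.Ioo (0 : ℝ) (1 / 2) := ⟨by linarith [hδ.1], by linarith [hδ.2]⟩
  unfold _root_.HubbardSuperconductivity Literature.Hubbard.DWaveSuperconductivityHubbard
  exact ⟨U, hU.1, δ, hδ', fun N ψ hyp => hmat N ψ hyp⟩

/-- **K3″ at a massive, onsite-clean box point decides the summit** (the two previous theorems composed):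
this is the exact sense in which the usable content of the crux is summit-strength. [folklore] -/
theorem hubbardSuperconductivity_of_bondLocalityAt_of_mass {U δ κ μ : ℝ} (hU : U ∈ Set.Ioc (0 : ℝ) 4)
    (hδ : δ ∈ Set.Icc (1 / 10 : ℝ) (3 / 10)) (hκ : 0 < κ) (hμ : 0 < μ)
    (hK3 : ∀ ε : ℝ, 0 < ε → ∃ L₀ : ℕ, ∀ (L : ℕ) [NeZero L], L₀ ≤ L → Even L →
      ∀ φ : Fock (Orb (FermionTorus 2 L)), star φ ⬝ᵥ φ = 1 →
        IsGroundStateInSector (hubbardTorus 2 L 1 U) (2 * ⌊(1 - δ) * (L : ℝ) ^ 2 / 2⌋₊) 0 φ →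
          κ * ((expect ((pairField sWave L)ᴴ * pairField sWave L)
                  (liebVec ⌊(1 - δ) * (L : ℝ) ^ 2 / 2⌋₊
                    (CFC.abs (liebW ⌊(1 - δ) * (L : ℝ) ^ 2 / 2⌋₊ φ)))).re -
                (expect ((pairField sWave L)ᴴ * pairField sWave L) φ).re) -
              ε * (L : ℝ) ^ 4 ≤
            (expect ((pairField dWaveFormFactor L)ᴴ * pairField dWaveFormFactor L) φ).re +
              (expect ((pairField extendedSWave L)ᴴ * pairField extendedSWave L) φ).re)
    (hm : ∃ L₀ : ℕ, ∀ (L : ℕ) [NeZero L], L₀ ≤ L → Even L →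
      ∀ φ : Fock (Orb (FermionTorus 2 L)), star φ ⬝ᵥ φ = 1 →
        IsGroundStateInSector (hubbardTorus 2 L 1 U) (2 * ⌊(1 - δ) * (L : ℝ) ^ 2 / 2⌋₊) 0 φ →
          μ * (L : ℝ) ^ 4 ≤
            (expect ((pairField sWave L)ᴴ * pairField sWave L)
                (liebVec ⌊(1 - δ) * (L : ℝ) ^ 2 / 2⌋₊
                  (CFC.abs (liebW ⌊(1 - δ) * (L : ℝ) ^ 2 / 2⌋₊ φ)))).re -
              (expect ((pairField sWave L)ᴴ * pairField sWave L) φ).re)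
    (hxs : ∀ ε : ℝ, 0 < ε → ∃ L₀ : ℕ, ∀ (L : ℕ) [NeZero L], L₀ ≤ L → Even L →
      ∀ φ : Fock (Orb (FermionTorus 2 L)), star φ ⬝ᵥ φ = 1 →
        IsGroundStateInSector (hubbardTorus 2 L 1 U) (2 * ⌊(1 - δ) * (L : ℝ) ^ 2 / 2⌋₊) 0 φ →
          (expect ((pairField extendedSWave L)ᴴ * pairField extendedSWave L) φ).re ≤ ε * (L : ℝ) ^ 4) :
    _root_.HubbardSuperconductivity :=
  hubbardSuperconductivity_of_dWaveFloorAt hU hδ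
    ⟨κ * μ / 2, by positivity, dWaveFloorAt_of_bondLocalityAt hκ hμ hK3 hm hxs⟩

end Pointwise

/-! ### Box statements in the route's vocabulary -/

/-- **The box-uniform summit matrix implies K3″** (bond locality, the registered stub
`stub_massFeedsBondSinglets` = hypothesis `hK3` of `LiebTwinBondLocality.hubbardSuperconductivity_of_bondLocality`):
if at every `(U, δ) ∈ (0,4] × [1/10,3/10]` every normalised sector ground state eventually has
`a(U,δ)·L⁴ ≤ F_d`, then K3″ holds (with `κ = a/2`). Reading: K3″ is weaker than the summit asserted
uniformly on the box, and (`dWaveFloorAt_of_bondLocalityAt`) equal to it at every massive point — its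
content, where it has any, is the summit's own matrix. Yang (1962) §4; Lieb (1989); Scalapino (1995) §2.
[folklore] -/
theorem bondLocality_of_uniformBoxDWaveFloor
    (hS : ∀ U ∈ Set.Ioc (0 : ℝ) 4, ∀ δ ∈ Set.Icc (1 / 10 : ℝ) (3 / 10), ∃ a : ℝ, 0 < a ∧ ∃ L₀ : ℕ,
      ∀ (L : ℕ) [NeZero L], L₀ ≤ L → Even L → ∀ φ : Fock (Orb (FermionTorus 2 L)), star φ ⬝ᵥ φ = 1 →
        IsGroundStateInSector (hubbardTorus 2 L 1 U) (2 * ⌊(1 - δ) * (L : ℝ) ^ 2 / 2⌋₊) 0 φ →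
          a * (L : ℝ) ^ 4 ≤ (expect ((pairField dWaveFormFactor L)ᴴ * pairField dWaveFormFactor L) φ).re) :
    ∀ U ∈ Set.Ioc (0 : ℝ) 4, ∀ δ ∈ Set.Icc (1 / 10 : ℝ) (3 / 10), ∃ κ : ℝ, 0 < κ ∧ ∀ ε : ℝ, 0 < ε →
      ∃ L₀ : ℕ, ∀ (L : ℕ) [NeZero L], L₀ ≤ L → Even L → ∀ φ : Fock (Orb (FermionTorus 2 L)),
        star φ ⬝ᵥ φ = 1 →
          IsGroundStateInSector (hubbardTorus 2 L 1 U) (2 * ⌊(1 - δ) * (L : ℝ) ^ 2 / 2⌋₊) 0 φ →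
            κ * ((expect ((pairField sWave L)ᴴ * pairField sWave L)
                    (liebVec ⌊(1 - δ) * (L : ℝ) ^ 2 / 2⌋₊
                      (CFC.abs (liebW ⌊(1 - δ) * (L : ℝ) ^ 2 / 2⌋₊ φ)))).re -
                  (expect ((pairField sWave L)ᴴ * pairField sWave L) φ).re) -
                ε * (L : ℝ) ^ 4 ≤
              (expect ((pairField dWaveFormFactor L)ᴴ * pairField dWaveFormFactor L) φ).re +
                (expect ((pairField extendedSWave L)ᴴ * pairField extendedSWave L) φ).re := by
  intro U hU δ hδ
  obtain ⟨a, ha, L₀, h⟩ := hS U hU δ hδ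
  exact ⟨a / 2, by positivity, fun ε hε => ⟨L₀, bondLocalityAt_of_dWaveFloorAt ha h hε⟩⟩

/-- **What K3′ adds to K3″: the twin never out-d-waves a real flip-definite ground state.** If the crux
`DWavePolarisedDiscordance` holds then, at every box point and for every `ε > 0`, eventually in even `L`,
every real normalised sector ground state with flip-definite Lieb matrix (`Wᵀ = ±W`, the class where the
mass is nonnegative, `LiebTwinDiscordance.re_expect_sWave_le_twin_of_real`) satisfies
`F_d(φ̃) ≤ F_d(φ) + εL⁴`. No summit-type statement implies this: it constrains the TWIN's d-wave order,
and a real flip-definite ground-state family with `F_d(φ̃) ≥ F_d(φ) + cL⁴` infinitely often refutes K3′.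
Lieb, PRL 62 (1989) 1201; Scalapino, Phys. Rep. 250 (1995) 329, §2. [folklore] -/
theorem twin_dWave_le_of_dWavePolarisedDiscordance
    (h : Summit.HubbardSuperconductivity.HubbardSuperconductivity.Theses.LiebTwin.DWavePolarisedDiscordance) :
    ∀ U ∈ Set.Ioc (0 : ℝ) 4, ∀ δ ∈ Set.Icc (1 / 10 : ℝ) (3 / 10), ∀ ε : ℝ, 0 < ε → ∃ L₀ : ℕ,
      ∀ (L : ℕ) [NeZero L], L₀ ≤ L → Even L → ∀ φ : Fock (Orb (FermionTorus 2 L)),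
        star φ ⬝ᵥ φ = 1 → (∀ s, star (φ s) = φ s) →
          ((liebW ⌊(1 - δ) * (L : ℝ) ^ 2 / 2⌋₊ φ)ᵀ = liebW ⌊(1 - δ) * (L : ℝ) ^ 2 / 2⌋₊ φ ∨
              (liebW ⌊(1 - δ) * (L : ℝ) ^ 2 / 2⌋₊ φ)ᵀ = -liebW ⌊(1 - δ) * (L : ℝ) ^ 2 / 2⌋₊ φ) →
            IsGroundStateInSector (hubbardTorus 2 L 1 U) (2 * ⌊(1 - δ) * (L : ℝ) ^ 2 / 2⌋₊) 0 φ →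
              (expect ((pairField dWaveFormFactor L)ᴴ * pairField dWaveFormFactor L)
                  (liebVec ⌊(1 - δ) * (L : ℝ) ^ 2 / 2⌋₊
                    (CFC.abs (liebW ⌊(1 - δ) * (L : ℝ) ^ 2 / 2⌋₊ φ)))).re ≤
                (expect ((pairField dWaveFormFactor L)ᴴ * pairField dWaveFormFactor L) φ).re +
                  ε * (L : ℝ) ^ 4 := by
  intro U hU δ hδ ε hε
  obtain ⟨κ, hκ, hK⟩ := h U hU δ hδ
  obtain ⟨L₀, hK⟩ := hK ε hε
  refine ⟨L₀, fun L _ hL hE φ hφ hreal hflip hgs => ?_⟩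
  set n := ⌊(1 - δ) * (L : ℝ) ^ 2 / 2⌋₊ with hn
  have key := hK L hL hE φ hφ hgs
  have hsec : IsInSector n n φ := (mem_szSector_two_mul_zero_iff n φ).1 hgs.1
  have hm := LiebTwinDiscordance.re_expect_sWave_le_twin_of_real hreal hsec hflip
  have hκm : 0 ≤ κ * ((expect ((pairField sWave L)ᴴ * pairField sWave L)
        (liebVec n (CFC.abs (liebW n φ)))).re -
      (expect ((pairField sWave L)ᴴ * pairField sWave L) φ).re) :=
    mul_nonneg hκ.le (by linarith)
  linarith

end Summit.HubbardSuperconductivity.HubbardSuperconductivity.Theorems.LiebTwinDiscordance.SummitSandwich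

end
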